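import Literature.Analysis.OperatorTheory.YangMillsMatrixModelRadialCutoff
import HarnessLib

/-!
# The quasimode package for Lüscher's matrix-model Hamiltonian: cut-off eigenfunctions form an almost-optimal
`(k+1)`-dimensional trial space, with `O(e^{−R})` errors — ASSEMBLED (theorems only)

Topic `Literature/Analysis/OperatorTheory`.  This file only ASSEMBLES, for the consumer of crux ONE
(`stub_absLower` of `stmt-QuantumFields-20007`), the pieces landed in
`YangMillsMatrixModelEigenfunctions.lean` (the named fact `LuscherHamiltonianEigenfunctions k`),
`YangMillsMatrixModelCutoffEnergy.lean` (§5 span energies, §6 exponential tails) and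
`YangMillsMatrixModelRadialCutoff.lean` (`radialCutoff R`, `radialCutoff_package`) into one statement in the shape of
Helffer's quasimode theorem [Helffer 1988, LNM 1336, §4.2, Prop. 4.1.1 / Thm. 4.2.1, (4.2.13)]: with
`χ_R = radialCutoff R` (`R ≥ 1`) and `F_a = Σ_j a_j f_j` the span of the first `k+1` invariant eigenfunctions,

  `𝔮(χ_R F_a) ≤ physLevel(k+1) · ‖χ_R F_a‖² + A e^{−R} Σ_{i,j} |a_i||a_j|`,
  `‖χ_R F_a‖² ≥ Σ_j a_j² − A e^{−R} Σ_{i,j} |a_i||a_j|`,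

for ONE constant `A = A(k) ≥ 0` — so the Rayleigh quotient on the `(k+1)`-dimensional space of colour-invariant
`C²_c` functions `χ_R F_a` is `≤ physLevel(k+1) + O_k(e^{−R})` (`Σ|a_i||a_j| ≤ (k+1)Σa_j²`).
[cite: Agmon1982, (1.16)–(1.16″), Cor. 4.5] [cite: ReedSimonIV1978, Thm. XIII.1, XIII.64]

No definitions, no named facts, 0 sorry.
-/

noncomputable section

open MeasureTheory Filter Topology Function
open scoped BigOperators

namespace Literature.Analysis.OperatorTheory.YMMatrixModel

section Quasimodes

variable {k : ℕ} {f : Fin (k + 1) → ZM → ℝ}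

/-- A uniform decay constant for a finite family with `ExpDecay₂`: one `C ≥ 0` with `|f_j(x)| ≤ C e^{−‖x‖}` for
all `j`. [cite: Agmon1982, Cor. 4.5] -/
theorem exists_uniform_decay (hdec : ∀ j, ExpDecay₂ (f j)) :
    ∃ C : ℝ, 0 ≤ C ∧ ∀ j, ∀ x : ZM, |f j x| ≤ C * Real.exp (-‖x‖) := by
  choose C hC0 hC using fun j => (hdec j).exists_abs_le
  refine ⟨∑ j, C j, Finset.sum_nonneg fun j _ => hC0 j, fun j x => (hC j x).trans ?_⟩
  exact mul_le_mul_of_nonneg_right (Finset.single_le_sum (fun i _ => hC0 i) (Finset.mem_univ j))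
    (Real.exp_pos _).le

/-- **The quasimode estimate with the radial cut-off** (all constants assembled).  For smooth `L²`-orthonormal
classical eigenfunctions `f_0,…,f_k` with `hApply f_j = physLevel(j+1) f_j` and `ExpDecay₂`, there is `A ≥ 0` such
that for every `R ≥ 1` and all coefficients `a`, with `χ_R = radialCutoff R` and `F_a = Σ_j a_j f_j`:
`𝔮(χ_R F_a) ≤ physLevel(k+1) · l2sq(χ_R F_a) + A e^{−R} Σ|a_i||a_j|` and
`Σ a_j² − A e^{−R} Σ|a_i||a_j| ≤ l2sq(χ_R F_a)`. [cite: Agmon1982, (1.16″), Cor. 4.5] [cite: ReedSimonIV1978, Thm. XIII.1] -/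
theorem quasimode_estimate (hsmooth : ∀ j, ∀ n : ℕ∞, ContDiff ℝ n (f j))
    (horth : ∀ i j, ∫ x, f i x * f j x = if i = j then (1 : ℝ) else 0)
    (heig : ∀ j, ∀ x : ZM, hApply (f j) x = physLevel ((j : ℕ) + 1) * f j x)
    (hdec : ∀ j, ExpDecay₂ (f j)) :
    ∃ A : ℝ, 0 ≤ A ∧ ∀ R : ℝ, 1 ≤ R → ∀ a : Fin (k + 1) → ℝ,
      energyForm (radialCutoff R * fun x => ∑ j, a j * f j x) ≤
          physLevel (k + 1) * l2sq (radialCutoff R * fun x => ∑ j, a j * f j x)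
            + A * Real.exp (-R) * ∑ i, ∑ j, |a i| * |a j| ∧
      ∑ j, a j ^ 2 - A * Real.exp (-R) * ∑ i, ∑ j, |a i| * |a j| ≤
          l2sq (radialCutoff R * fun x => ∑ j, a j * f j x) := by
  obtain ⟨C, hC0, hC⟩ := exists_uniform_decay hdec
  obtain ⟨M₁, hM0, hpack⟩ := radialCutoff_package
  set E : ℝ := physLevel (k + 1) with hE_def
  have hE0 : 0 ≤ E := physLevel_nonneg (Nat.succ_le_succ (Nat.zero_le k))
  set I₉ : ℝ := ∫ x : ZM, Real.exp (-‖x‖) with hI₉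
  have hI0 : 0 ≤ I₉ := integral_nonneg fun x => (Real.exp_pos _).le
  have hfc : ∀ j, Continuous (f j) := fun j => (contDiff_two_of_forall (hsmooth j)).continuous
  -- the constant
  refine ⟨(E + M₁ / 2 + 1) * C ^ 2 * I₉, by positivity, fun R hR a => ?_⟩
  obtain ⟨hχ, _, hone, habs, hgrad⟩ := hpack R hR
  -- the two tails are `≤ (…) · C² e^{−R} I₉`
  have hT : ∀ i j, |∫ x, (1 - radialCutoff R x ^ 2) * (f i x * f j x)| ≤ 1 * C * C * Real.exp (-R) * I₉ :=
    fun i j => abs_tail_le (hC i) (hC j) habs hone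
  have hD : ∀ i j, |∫ x, ‖gradient (radialCutoff R) x‖ ^ 2 * (f i x * f j x)| ≤ M₁ * C * C * Real.exp (-R) * I₉ :=
    fun i j => abs_gradTail_le (hC i) (hC j) hgrad hone
  have hEj : ∀ j : Fin (k + 1), 0 ≤ physLevel ((j : ℕ) + 1) := fun j =>
    physLevel_nonneg (Nat.succ_le_succ (Nat.zero_le _))
  have hterm : ∀ i j : Fin (k + 1),
      (E - physLevel ((j : ℕ) + 1)) * |∫ x, (1 - radialCutoff R x ^ 2) * (f i x * f j x)|
        + (1 / 2 : ℝ) * |∫ x, ‖gradient (radialCutoff R) x‖ ^ 2 * (f i x * f j x)|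
      ≤ (E + M₁ / 2 + 1) * C ^ 2 * I₉ * Real.exp (-R) := by
    intro i j
    have h1 : (E - physLevel ((j : ℕ) + 1)) * |∫ x, (1 - radialCutoff R x ^ 2) * (f i x * f j x)|
        ≤ E * (1 * C * C * Real.exp (-R) * I₉) :=
      mul_le_mul (by linarith [hEj j]) (hT i j) (abs_nonneg _) hE0
    have h2 : (1 / 2 : ℝ) * |∫ x, ‖gradient (radialCutoff R) x‖ ^ 2 * (f i x * f j x)|
        ≤ (1 / 2 : ℝ) * (M₁ * C * C * Real.exp (-R) * I₉) :=
      mul_le_mul_of_nonneg_left (hD i j) (by norm_num)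
    have h3 : 0 ≤ C ^ 2 * I₉ * Real.exp (-R) := by positivity
    nlinarith [h1, h2, h3]
  constructor
  · -- the energy bound
    have h := energyForm_span_le_physLevel hχ hsmooth horth heig a
    have hsum : ∑ i, ∑ j, |a i| * |a j| *
        ((physLevel (k + 1) - physLevel ((j : ℕ) + 1)) * |∫ x, (1 - radialCutoff R x ^ 2) * (f i x * f j x)|
          + (1 / 2 : ℝ) * |∫ x, ‖gradient (radialCutoff R) x‖ ^ 2 * (f i x * f j x)|)
        ≤ ∑ i, ∑ j, |a i| * |a j| * ((E + M₁ / 2 + 1) * C ^ 2 * I₉ * Real.exp (-R)) :=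
      Finset.sum_le_sum fun i _ => Finset.sum_le_sum fun j _ =>
        mul_le_mul_of_nonneg_left (hterm i j) (mul_nonneg (abs_nonneg _) (abs_nonneg _))
    have hre : ∑ i, ∑ j, |a i| * |a j| * ((E + M₁ / 2 + 1) * C ^ 2 * I₉ * Real.exp (-R)) =
        (E + M₁ / 2 + 1) * C ^ 2 * I₉ * Real.exp (-R) * ∑ i, ∑ j, |a i| * |a j| := by
      rw [Finset.mul_sum]
      refine Finset.sum_congr rfl fun i _ => ?_
      rw [Finset.mul_sum]
      exact Finset.sum_congr rfl fun j _ => by ring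
    rw [hre] at hsum
    linarith [h, hsum]
  · -- the mass bound
    have h := sum_sq_sub_le_l2sq_span hχ hfc horth a
    have hsum : ∑ i, ∑ j, |a i| * |a j| * |∫ x, (1 - radialCutoff R x ^ 2) * (f i x * f j x)|
        ≤ ∑ i, ∑ j, |a i| * |a j| * ((E + M₁ / 2 + 1) * C ^ 2 * I₉ * Real.exp (-R)) :=
      Finset.sum_le_sum fun i _ => Finset.sum_le_sum fun j _ =>
        mul_le_mul_of_nonneg_left ((hT i j).trans (by
          have h3 : 0 ≤ C ^ 2 * I₉ * Real.exp (-R) := by positivity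
          nlinarith [h3])) (mul_nonneg (abs_nonneg _) (abs_nonneg _))
    have hre : ∑ i, ∑ j, |a i| * |a j| * ((E + M₁ / 2 + 1) * C ^ 2 * I₉ * Real.exp (-R)) =
        (E + M₁ / 2 + 1) * C ^ 2 * I₉ * Real.exp (-R) * ∑ i, ∑ j, |a i| * |a j| := by
      rw [Finset.mul_sum]
      refine Finset.sum_congr rfl fun i _ => ?_
      rw [Finset.mul_sum]
      exact Finset.sum_congr rfl fun j _ => by ring
    rw [hre] at hsum
    linarith [h, hsum]

/-- **The quasimode package from the named fact.**  Under `LuscherHamiltonianEigenfunctions k`: there are `k+1`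
smooth, colour-invariant, `L²`-orthonormal, exponentially decaying classical eigenfunctions `f_j`
(`hApply f_j = physLevel(j+1) f_j`) AND a constant `A ≥ 0` such that for every `R ≥ 1` the cut-off span
`χ_R F_a` (`χ_R = radialCutoff R ∈ C²_c` colour-invariant, so each `χ_R f_j` is an admissible invariant test function)
satisfies the two displayed inequalities — the trial space for the upper bound `levels ≤ physLevel(k+1) + O(e^{−R})`
by min–max. [cite: Agmon1982, (1.16″), Cor. 4.5] [cite: ReedSimonIV1978, Thm. XIII.1, XIII.64] -/
theorem LuscherHamiltonianEigenfunctions.quasimodes (h : LuscherHamiltonianEigenfunctions k) :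
    ∃ f : Fin (k + 1) → ZM → ℝ,
      (∀ j, ∀ n : ℕ∞, ContDiff ℝ n (f j)) ∧ (∀ j, IsGaugeInv (f j)) ∧
      (∀ i j, ∫ x, f i x * f j x = if i = j then (1 : ℝ) else 0) ∧
      (∀ j, ∀ x : ZM, hApply (f j) x = physLevel ((j : ℕ) + 1) * f j x) ∧
      (∀ j, ExpDecay₂ (f j)) ∧
      ∃ A : ℝ, 0 ≤ A ∧ ∀ R : ℝ, 1 ≤ R → ∀ a : Fin (k + 1) → ℝ,
        energyForm (radialCutoff R * fun x => ∑ j, a j * f j x) ≤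
            physLevel (k + 1) * l2sq (radialCutoff R * fun x => ∑ j, a j * f j x)
              + A * Real.exp (-R) * ∑ i, ∑ j, |a i| * |a j| ∧
        ∑ j, a j ^ 2 - A * Real.exp (-R) * ∑ i, ∑ j, |a i| * |a j| ≤
            l2sq (radialCutoff R * fun x => ∑ j, a j * f j x) := by
  obtain ⟨f, hsmooth, hinv, horth, heig, hdec⟩ := h
  exact ⟨f, hsmooth, hinv, horth, heig, hdec, quasimode_estimate hsmooth horth heig hdec⟩

/-- The cut-off span consists of colour-invariant `C²_c` functions (admissible for `physLevel`'s min–max):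
`IsTestFn (χ_R F_a)` and `IsGaugeInv (χ_R F_a)` for `R > 0`. [cite: ReedSimonIV1978, Thm. XIII.2] -/
theorem isTestFn_isGaugeInv_radialCutoff_mul_span {R : ℝ} (hR : 0 < R)
    (hsmooth : ∀ j, ∀ n : ℕ∞, ContDiff ℝ n (f j)) (hinv : ∀ j, IsGaugeInv (f j)) (a : Fin (k + 1) → ℝ) :
    IsTestFn (radialCutoff R * fun x => ∑ j, a j * f j x) ∧
      IsGaugeInv (radialCutoff R * fun x => ∑ j, a j * f j x) := by
  have hχ := isTestFn_radialCutoff hR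
  refine ⟨⟨?_, ?_⟩, ?_⟩
  · have h2 : ContDiff ℝ 2 (fun x => ∑ j, a j * f j x) := contDiff_sum_mul (fun j => contDiff_two_of_forall (hsmooth j)) a
    exact hχ.1.mul h2
  · exact hχ.2.mul_right
  · intro M hM x
    simp only [Pi.mul_apply]
    rw [isGaugeInv_radialCutoff R M hM x]
    congr 1
    exact Finset.sum_congr rfl fun j _ => by rw [hinv j M hM x]

end Quasimodes

end Literature.Analysis.OperatorTheory.YMMatrixModel

end
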